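import Summits.Parity.BatemanHorn.Theorems.SoloInformedTwinUnbalancedFullBound

/-!
# The unbalanced twin sum — IX: (F′) in the kernel and the unconditional headline (file F5b)

Soloist file (informed mode), the last file of the kernel project for (F′).  With the prose
parameters `y = ⌊x^{1-ε}⌋`, `z = ⌊x^{1/2-ε₀}⌋` (`0 < ε < ε₀ < 1/2`, nothing else) we choose the
regime-(1a) cut `K₀ = ⌊x^θ⌋`, `θ = min(ε₀, 1/4)` and the BFI margin `ε' = θ/8`, verify that all
twelve hypotheses of `abs_twinUnbalancedSum_le_full` hold eventually (`eventually_fullRegime`),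
and conclude

* `twinUnbalancedSum_isLittleO` — **(F′)**: `U(x; ⌊x^{1-ε}⌋, ⌊x^{1/2-ε₀}⌋) = o(x)` for all
  `0 < ε < ε₀ < 1/2` (Bombieri–Vinogradov for `μ` below `K₀`, Bombieri–Friedlander–Iwaniec above);
* `twinPrime_iff_balancedSum_rpow_all` — the headline with NO hypothesis: for `0 < ε < ε₀ < 1/2`,
  `π₂(x) ~ 2C₂ x/log²x ⟺ ∑_{e₁,e₂ > x^{1/2-ε₀}, e₁e₂ > x^{1-ε}} μ(e₁)μ(e₂) log²(e₁e₂) N(e₁,e₂;x) = o(x)`;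
* `twinPrime_iff_balancedFarTail_rpow_all` — the product-window form under the one prose
  premise (F) only.
-/

namespace Summit.Parity.BatemanHorn.Theorems

open Finset Real Filter Asymptotics
open scoped ArithmeticFunction.Moebius
open Literature.NumberTheory.Sieve

/-! ### 1. A small real-variable helper -/

/-- `(t+2)^a ≤ 2 t^a` for `t ≥ 2`, `0 ≤ a ≤ 1`. -/
theorem add_two_rpow_le_two_mul {t a : ℝ} (ht : 2 ≤ t) (ha0 : 0 ≤ a) (ha1 : a ≤ 1) :
    (t + 2) ^ a ≤ 2 * t ^ a := by
  have h1 : (t + 2) ^ a ≤ (2 * t) ^ a := Real.rpow_le_rpow (by linarith) (by linarith) ha0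
  have h2 : (2 * t) ^ a = (2 : ℝ) ^ a * t ^ a := Real.mul_rpow (by norm_num) (by linarith)
  have h3 : (2 : ℝ) ^ a ≤ 2 := by
    calc (2 : ℝ) ^ a ≤ (2 : ℝ) ^ (1 : ℝ) := Real.rpow_le_rpow_of_exponent_le (by norm_num) ha1
      _ = 2 := Real.rpow_one 2
  calc (t + 2) ^ a ≤ (2 : ℝ) ^ a * t ^ a := h1.trans h2.le
    _ ≤ 2 * t ^ a := mul_le_mul_of_nonneg_right h3 (Real.rpow_nonneg (by linarith) a)

/-! ### 2. The prose parameters eventually satisfy every hypothesis of the full bound -/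

/-- Basic size conditions: for large `x`, with `y = ⌊x^{1-ε}⌋`, `z = ⌊x^{1/2-ε₀}⌋`,
`K = ⌊(x+2)z/y⌋`: `x ≥ X₀`, `z² ≤ y ≤ x`, `1 ≤ z ≤ x`, `(x+2)z ≤ (K+1)y`. -/
theorem eventually_fullRegime_basic {ε ε₀ : ℝ} (hε : 0 < ε) (hε₀ : ε < ε₀) (hε₀' : ε₀ < 1 / 2)
    (X₀ : ℝ) :
    ∀ᶠ x : ℕ in atTop, X₀ ≤ (x : ℝ) ∧
      balanceCut ε₀ x * balanceCut ε₀ x ≤ rpowCut ε x ∧ rpowCut ε x ≤ x ∧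
      1 ≤ balanceCut ε₀ x ∧ balanceCut ε₀ x ≤ x ∧
      (x + 2) * balanceCut ε₀ x ≤ ((x + 2) * balanceCut ε₀ x / rpowCut ε x + 1) * rpowCut ε x := by
  have f3 : ∀ᶠ t : ℝ in atTop, 2 ≤ t ^ (1 - ε) :=
    (tendsto_rpow_atTop (by linarith)).eventually_ge_atTop 2
  have f4 : ∀ᶠ t : ℝ in atTop, 1 * t ^ (1 - 2 * ε₀) * Real.log t ^ (0 : ℝ)
      ≤ (1 / 2) * t ^ (1 - ε) :=
    eventually_mul_rpow_mul_log_rpow_le (by linarith) 0 1 (by norm_num)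
  have hev := tendsto_natCast_atTop_atTop.eventually
    ((eventually_ge_atTop X₀).and ((eventually_ge_atTop 4).and (f3.and f4)))
  filter_upwards [hev] with x hx
  obtain ⟨h1, h4t, h3t, h4'⟩ := hx
  set t : ℝ := (x : ℝ) with htdef
  have ht1 : 1 ≤ t := by linarith
  have ht0 : 0 < t := by linarith
  simp only [Real.rpow_zero, mul_one, one_mul] at h4'
  have hydef : rpowCut ε x = ⌊t ^ (1 - ε)⌋₊ := rfl
  have hzdef : balanceCut ε₀ x = ⌊t ^ (1 / 2 - ε₀)⌋₊ := rfl
  set y : ℕ := rpowCut ε x with hy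
  set z : ℕ := balanceCut ε₀ x with hz
  have hy_le : (y : ℝ) ≤ t ^ (1 - ε) := by rw [hydef]; exact Nat.floor_le (Real.rpow_nonneg ht0.le _)
  have hy_gt : t ^ (1 - ε) - 1 < y := by rw [hydef]; exact Nat.sub_one_lt_floor _
  have hy0 : 0 < y := by exact_mod_cast (show (0 : ℝ) < y by linarith)
  have hz_le : (z : ℝ) ≤ t ^ (1 / 2 - ε₀) := by
    rw [hzdef]; exact Nat.floor_le (Real.rpow_nonneg ht0.le _)
  have hz0 : (0 : ℝ) ≤ z := Nat.cast_nonneg z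
  have hta0 : 0 ≤ t ^ (1 / 2 - ε₀) := Real.rpow_nonneg ht0.le _
  refine ⟨h1, ?_, ?_, ?_, ?_, ?_⟩
  · -- `z² ≤ y`
    have : (z : ℝ) * z ≤ y := by
      calc (z : ℝ) * z ≤ t ^ (1 / 2 - ε₀) * t ^ (1 / 2 - ε₀) := mul_le_mul hz_le hz_le hz0 hta0
        _ = t ^ (1 - 2 * ε₀) := by
            rw [← Real.rpow_add ht0]; ring_nf
        _ ≤ 1 / 2 * t ^ (1 - ε) := h4'
        _ ≤ y := by linarith
    exact_mod_cast this
  · -- `y ≤ x`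
    have : (y : ℝ) ≤ t := by
      refine hy_le.trans ?_
      calc t ^ (1 - ε) ≤ t ^ (1 : ℝ) := Real.rpow_le_rpow_of_exponent_le ht1 (by linarith)
        _ = t := Real.rpow_one t
    rw [htdef] at this
    exact_mod_cast this
  · -- `1 ≤ z`
    rw [hzdef]
    refine Nat.le_floor ?_
    rw [Nat.cast_one]
    exact Real.one_le_rpow ht1 (by linarith)
  · -- `z ≤ x`
    have : (z : ℝ) ≤ t := by
      refine hz_le.trans ?_
      calc t ^ (1 / 2 - ε₀) ≤ t ^ (1 : ℝ) := Real.rpow_le_rpow_of_exponent_le ht1 (by linarith)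
        _ = t := Real.rpow_one t
    rw [htdef] at this
    exact_mod_cast this
  · -- `(x+2) z ≤ (K+1) y`
    have := @Nat.lt_div_mul_add ((x + 2) * z) y hy0
    rw [add_one_mul]
    exact this.le

/-- The cut `K₀ = ⌊x^θ⌋` (`0 < θ ≤ min(ε₀, 1/4)`) is eventually in regime (1a) and above the BFI
threshold `(x+2)^{θ/2}`: `2 ≤ K₀`, `K₀ (2z log^B(x+2))² ≤ ⌊x/2⌋`, `K₀ (x+2)^{1/2} ≤ ⌊x/2⌋`,
`(x+2)^{4(θ/8)} ≤ K₀`. -/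
theorem eventually_fullRegime_cut {ε₀ θ : ℝ} (hε₀ : 0 < ε₀) (hθ : 0 < θ) (hθ1 : θ ≤ ε₀)
    (hθ2 : θ ≤ 1 / 4) {B : ℝ} (hB : 0 < B) :
    ∀ᶠ x : ℕ in atTop, 2 ≤ ⌊(x : ℝ) ^ θ⌋₊ ∧
      ((⌊(x : ℝ) ^ θ⌋₊ : ℕ) : ℝ)
          * (2 * (balanceCut ε₀ x : ℝ) * Real.log ((x : ℝ) + 2) ^ B) ^ 2 ≤ ((x / 2 : ℕ) : ℝ) ∧
      ((⌊(x : ℝ) ^ θ⌋₊ : ℕ) : ℝ) * ((x : ℝ) + 2) ^ (1 / 2 : ℝ) ≤ ((x / 2 : ℕ) : ℝ) ∧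
      ((x : ℝ) + 2) ^ (4 * (θ / 8)) ≤ ((⌊(x : ℝ) ^ θ⌋₊ : ℕ) : ℝ) := by
  have f5 : ∀ᶠ t : ℝ in atTop,
      (4 * ((2 : ℝ) ^ B) ^ 2) * t ^ (θ + (1 / 2 - ε₀) * 2) * Real.log t ^ (B * 2)
        ≤ (1 / 4) * t ^ (1 : ℝ) :=
    eventually_mul_rpow_mul_log_rpow_le (by linarith) _ _ (by norm_num)
  have f6 : ∀ᶠ t : ℝ in atTop,
      2 * t ^ (θ + 1 / 2) * Real.log t ^ (0 : ℝ) ≤ (1 / 4) * t ^ (1 : ℝ) :=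
    eventually_mul_rpow_mul_log_rpow_le (by linarith) _ _ (by norm_num)
  have f7 : ∀ᶠ t : ℝ in atTop, 3 * t ^ (θ / 2) * Real.log t ^ (0 : ℝ) ≤ 1 * t ^ θ :=
    eventually_mul_rpow_mul_log_rpow_le (by linarith) _ _ (by norm_num)
  have f8 : ∀ᶠ t : ℝ in atTop, 3 ≤ t ^ (θ / 2) :=
    (tendsto_rpow_atTop (by linarith)).eventually_ge_atTop 3
  have hev := tendsto_natCast_atTop_atTop.eventually
    ((eventually_ge_atTop 4).and (f5.and (f6.and (f7.and f8))))
  filter_upwards [hev] with x hx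
  obtain ⟨h4t, h5', h6', h7', h8'⟩ := hx
  set t : ℝ := (x : ℝ) with htdef
  have ht2 : 2 ≤ t := by linarith
  have ht1 : 1 ≤ t := by linarith
  have ht0 : 0 < t := by linarith
  have hl0 : 0 ≤ Real.log t := Real.log_nonneg ht1
  simp only [Real.rpow_zero, mul_one, one_mul, Real.rpow_one] at h5' h6' h7'
  have hzdef : balanceCut ε₀ x = ⌊t ^ (1 / 2 - ε₀)⌋₊ := rfl
  set z : ℕ := balanceCut ε₀ x with hz
  set K₀ : ℕ := ⌊t ^ θ⌋₊ with hK₀def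
  have hz_le : (z : ℝ) ≤ t ^ (1 / 2 - ε₀) := by
    rw [hzdef]; exact Nat.floor_le (Real.rpow_nonneg ht0.le _)
  have hz0 : (0 : ℝ) ≤ z := Nat.cast_nonneg z
  have hK₀le : (K₀ : ℝ) ≤ t ^ θ := by
    rw [hK₀def]; exact Nat.floor_le (Real.rpow_nonneg ht0.le _)
  have hK₀gt : t ^ θ - 1 < K₀ := by rw [hK₀def]; exact Nat.sub_one_lt_floor _
  have htθ0 : 0 ≤ t ^ θ := Real.rpow_nonneg ht0.le _
  -- `⌊x/2⌋ ≥ (t-1)/2 ≥ t/4`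
  have hhalf : (t - 1) / 2 ≤ ((x / 2 : ℕ) : ℝ) := by
    have : (x : ℝ) ≤ 2 * ((x / 2 : ℕ) : ℝ) + 1 := by
      exact_mod_cast (show x ≤ 2 * (x / 2) + 1 by omega)
    rw [htdef]; linarith
  have hquarter : t / 4 ≤ ((x / 2 : ℕ) : ℝ) := by linarith
  -- `log^B (t+2) ≤ 2^B log^B t`
  have hlog2 : Real.log (t + 2) ≤ 2 * Real.log t := by
    have h := Real.log_le_log (by linarith : 0 < t + 2) (show t + 2 ≤ t ^ 2 by nlinarith)
    rw [Real.log_pow] at h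
    push_cast at h
    exact h
  have hl2_0 : 0 ≤ Real.log (t + 2) := Real.log_nonneg (by linarith)
  have hLB : Real.log (t + 2) ^ B ≤ (2 : ℝ) ^ B * Real.log t ^ B := by
    rw [← Real.mul_rpow (by norm_num) hl0]
    exact Real.rpow_le_rpow hl2_0 hlog2 hB.le
  have hLB0 : 0 ≤ Real.log (t + 2) ^ B := Real.rpow_nonneg hl2_0 _
  refine ⟨?_, ?_, ?_, ?_⟩
  · -- `2 ≤ K₀`
    have : (2 : ℝ) ≤ K₀ := by linarith
    exact_mod_cast this
  · -- regime (1a), first condition, for `K₀`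
    have hin0 : 0 ≤ 2 * (z : ℝ) * Real.log (t + 2) ^ B := by positivity
    have h2z : 2 * (z : ℝ) ≤ 2 * t ^ (1 / 2 - ε₀) := by linarith
    have hin : 2 * (z : ℝ) * Real.log (t + 2) ^ B
        ≤ 2 * t ^ (1 / 2 - ε₀) * ((2 : ℝ) ^ B * Real.log t ^ B) :=
      mul_le_mul h2z hLB hLB0 (by positivity)
    have hsq1 : (t ^ (1 / 2 - ε₀)) ^ 2 = t ^ ((1 / 2 - ε₀) * 2) := by
      rw [Real.rpow_mul ht0.le, Real.rpow_two]
    have hsq2 : (Real.log t ^ B) ^ 2 = Real.log t ^ (B * 2) := by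
      rw [Real.rpow_mul hl0, Real.rpow_two]
    calc (K₀ : ℝ) * (2 * (z : ℝ) * Real.log (t + 2) ^ B) ^ 2
        ≤ t ^ θ * (2 * t ^ (1 / 2 - ε₀) * ((2 : ℝ) ^ B * Real.log t ^ B)) ^ 2 :=
          mul_le_mul hK₀le (pow_le_pow_left₀ hin0 hin 2) (by positivity) htθ0
      _ = 4 * ((2 : ℝ) ^ B) ^ 2 * (t ^ θ * (t ^ (1 / 2 - ε₀)) ^ 2)
            * (Real.log t ^ B) ^ 2 := by ring
      _ = 4 * ((2 : ℝ) ^ B) ^ 2 * t ^ (θ + (1 / 2 - ε₀) * 2) * Real.log t ^ (B * 2) := by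
          rw [hsq1, hsq2, ← Real.rpow_add ht0]
      _ ≤ 1 / 4 * t := h5'
      _ = t / 4 := by ring
      _ ≤ ((x / 2 : ℕ) : ℝ) := hquarter
  · -- regime (1a), second condition, for `K₀`
    have hsqrt : (t + 2) ^ (1 / 2 : ℝ) ≤ 2 * t ^ (1 / 2 : ℝ) :=
      add_two_rpow_le_two_mul ht2 (by norm_num) (by norm_num)
    calc (K₀ : ℝ) * (t + 2) ^ (1 / 2 : ℝ)
        ≤ t ^ θ * (2 * t ^ (1 / 2 : ℝ)) :=
          mul_le_mul hK₀le hsqrt (Real.rpow_nonneg (by linarith) _) htθ0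
      _ = 2 * (t ^ θ * t ^ (1 / 2 : ℝ)) := by ring
      _ = 2 * t ^ (θ + 1 / 2) := by rw [← Real.rpow_add ht0]
      _ ≤ 1 / 4 * t := h6'
      _ = t / 4 := by ring
      _ ≤ ((x / 2 : ℕ) : ℝ) := hquarter
  · -- `(x+2)^{4ε'} ≤ K₀`
    rw [show 4 * (θ / 8) = θ / 2 by ring]
    have hA : (t + 2) ^ (θ / 2) ≤ 2 * t ^ (θ / 2) :=
      add_two_rpow_le_two_mul ht2 (by linarith) (by linarith)
    linarith

/-- The level conditions of regime (1b): eventually `z² log^B (x+2) ≤ y` and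
`2 z (x+2)^{θ/8} ≤ y` (`0 < ε < ε₀ < 1/2`, `0 < θ ≤ 1/4`, `B > 0`). -/
theorem eventually_fullRegime_level {ε ε₀ θ : ℝ} (hε : 0 < ε) (hε₀ : ε < ε₀) (hε₀' : ε₀ < 1 / 2)
    (hθ : 0 < θ) (hθ2 : θ ≤ 1 / 4) {B : ℝ} (hB : 0 < B) :
    ∀ᶠ x : ℕ in atTop,
      ((balanceCut ε₀ x : ℕ) : ℝ) ^ 2 * Real.log ((x : ℝ) + 2) ^ B ≤ (rpowCut ε x : ℝ) ∧
      2 * (balanceCut ε₀ x : ℝ) * ((x : ℝ) + 2) ^ (θ / 8) ≤ (rpowCut ε x : ℝ) := by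
  have f3 : ∀ᶠ t : ℝ in atTop, 2 ≤ t ^ (1 - ε) :=
    (tendsto_rpow_atTop (by linarith)).eventually_ge_atTop 2
  have f9 : ∀ᶠ t : ℝ in atTop, (2 : ℝ) ^ B * t ^ (1 - 2 * ε₀) * Real.log t ^ B
      ≤ (1 / 2) * t ^ (1 - ε) :=
    eventually_mul_rpow_mul_log_rpow_le (by linarith) _ _ (by norm_num)
  have f10 : ∀ᶠ t : ℝ in atTop, 4 * t ^ (1 / 2 - ε₀ + θ / 8) * Real.log t ^ (0 : ℝ)
      ≤ (1 / 2) * t ^ (1 - ε) :=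
    eventually_mul_rpow_mul_log_rpow_le (by linarith) _ _ (by norm_num)
  have hev := tendsto_natCast_atTop_atTop.eventually
    ((eventually_ge_atTop 4).and (f3.and (f9.and f10)))
  filter_upwards [hev] with x hx
  obtain ⟨h4t, h3t, h9', h10'⟩ := hx
  set t : ℝ := (x : ℝ) with htdef
  have ht2 : 2 ≤ t := by linarith
  have ht1 : 1 ≤ t := by linarith
  have ht0 : 0 < t := by linarith
  have hl0 : 0 ≤ Real.log t := Real.log_nonneg ht1
  simp only [Real.rpow_zero, mul_one] at h10'
  have hydef : rpowCut ε x = ⌊t ^ (1 - ε)⌋₊ := rfl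
  have hzdef : balanceCut ε₀ x = ⌊t ^ (1 / 2 - ε₀)⌋₊ := rfl
  set y : ℕ := rpowCut ε x with hy
  set z : ℕ := balanceCut ε₀ x with hz
  have hy_gt : t ^ (1 - ε) - 1 < y := by rw [hydef]; exact Nat.sub_one_lt_floor _
  have hy2 : t ^ (1 - ε) / 2 ≤ y := by linarith
  have hz_le : (z : ℝ) ≤ t ^ (1 / 2 - ε₀) := by
    rw [hzdef]; exact Nat.floor_le (Real.rpow_nonneg ht0.le _)
  have hz0 : (0 : ℝ) ≤ z := Nat.cast_nonneg z
  have hta0 : 0 ≤ t ^ (1 / 2 - ε₀) := Real.rpow_nonneg ht0.le _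
  -- `log^B (t+2) ≤ 2^B log^B t`
  have hlog2 : Real.log (t + 2) ≤ 2 * Real.log t := by
    have h := Real.log_le_log (by linarith : 0 < t + 2) (show t + 2 ≤ t ^ 2 by nlinarith)
    rw [Real.log_pow] at h
    push_cast at h
    exact h
  have hl2_0 : 0 ≤ Real.log (t + 2) := Real.log_nonneg (by linarith)
  have hLB : Real.log (t + 2) ^ B ≤ (2 : ℝ) ^ B * Real.log t ^ B := by
    rw [← Real.mul_rpow (by norm_num) hl0]
    exact Real.rpow_le_rpow hl2_0 hlog2 hB.le
  have hLB0 : 0 ≤ Real.log (t + 2) ^ B := Real.rpow_nonneg hl2_0 _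
  have hzz : (z : ℝ) * z ≤ t ^ (1 - 2 * ε₀) := by
    calc (z : ℝ) * z ≤ t ^ (1 / 2 - ε₀) * t ^ (1 / 2 - ε₀) := mul_le_mul hz_le hz_le hz0 hta0
      _ = t ^ (1 - 2 * ε₀) := by
          rw [← Real.rpow_add ht0]; ring_nf
  refine ⟨?_, ?_⟩
  · -- the level condition `z² log^B (x+2) ≤ y`
    have hz2 : (z : ℝ) ^ 2 ≤ t ^ (1 - 2 * ε₀) := by rw [sq]; exact hzz
    calc (z : ℝ) ^ 2 * Real.log (t + 2) ^ B
        ≤ t ^ (1 - 2 * ε₀) * ((2 : ℝ) ^ B * Real.log t ^ B) :=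
          mul_le_mul hz2 hLB hLB0 (Real.rpow_nonneg ht0.le _)
      _ = (2 : ℝ) ^ B * t ^ (1 - 2 * ε₀) * Real.log t ^ B := by ring
      _ ≤ 1 / 2 * t ^ (1 - ε) := h9'
      _ ≤ y := by linarith
  · -- `2 z (x+2)^{θ/8} ≤ y`
    have hA : (t + 2) ^ (θ / 8) ≤ 2 * t ^ (θ / 8) :=
      add_two_rpow_le_two_mul ht2 (by linarith) (by linarith)
    have h2z : 2 * (z : ℝ) ≤ 2 * t ^ (1 / 2 - ε₀) := by linarith
    have ht20 : (0 : ℝ) ≤ (t + 2) ^ (θ / 8) := Real.rpow_nonneg (by linarith) _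
    have hb0 : (0 : ℝ) ≤ 2 * t ^ (1 / 2 - ε₀) := by positivity
    calc 2 * (z : ℝ) * (t + 2) ^ (θ / 8)
        ≤ 2 * t ^ (1 / 2 - ε₀) * (2 * t ^ (θ / 8)) := mul_le_mul h2z hA ht20 hb0
      _ = 4 * (t ^ (1 / 2 - ε₀) * t ^ (θ / 8)) := by ring
      _ = 4 * t ^ (1 / 2 - ε₀ + θ / 8) := by rw [← Real.rpow_add ht0]
      _ ≤ 1 / 2 * t ^ (1 - ε) := h10'
      _ ≤ y := by linarith

/-- For `0 < ε < ε₀ < 1/2`, `0 < θ ≤ min(ε₀, 1/4)`, any `B > 0` and `X₀`: for all large `x`, with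
`y = ⌊x^{1-ε}⌋`, `z = ⌊x^{1/2-ε₀}⌋`, `K = ⌊(x+2)z/y⌋`, `K₀ = ⌊x^θ⌋`, `ε' = θ/8`, the twelve
hypotheses of `abs_twinUnbalancedSum_le_full` hold. -/
theorem eventually_fullRegime {ε ε₀ θ : ℝ} (hε : 0 < ε) (hε₀ : ε < ε₀) (hε₀' : ε₀ < 1 / 2)
    (hθ : 0 < θ) (hθ1 : θ ≤ ε₀) (hθ2 : θ ≤ 1 / 4) {B : ℝ} (hB : 0 < B) (X₀ : ℝ) :
    ∀ᶠ x : ℕ in atTop, X₀ ≤ (x : ℝ) ∧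
      balanceCut ε₀ x * balanceCut ε₀ x ≤ rpowCut ε x ∧ rpowCut ε x ≤ x ∧
      1 ≤ balanceCut ε₀ x ∧ balanceCut ε₀ x ≤ x ∧
      (x + 2) * balanceCut ε₀ x ≤ ((x + 2) * balanceCut ε₀ x / rpowCut ε x + 1) * rpowCut ε x ∧
      2 ≤ ⌊(x : ℝ) ^ θ⌋₊ ∧
      ((⌊(x : ℝ) ^ θ⌋₊ : ℕ) : ℝ)
          * (2 * (balanceCut ε₀ x : ℝ) * Real.log ((x : ℝ) + 2) ^ B) ^ 2 ≤ ((x / 2 : ℕ) : ℝ) ∧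
      ((⌊(x : ℝ) ^ θ⌋₊ : ℕ) : ℝ) * ((x : ℝ) + 2) ^ (1 / 2 : ℝ) ≤ ((x / 2 : ℕ) : ℝ) ∧
      ((x : ℝ) + 2) ^ (4 * (θ / 8)) ≤ ((⌊(x : ℝ) ^ θ⌋₊ : ℕ) : ℝ) ∧
      ((balanceCut ε₀ x : ℕ) : ℝ) ^ 2 * Real.log ((x : ℝ) + 2) ^ B ≤ (rpowCut ε x : ℝ) ∧
      2 * (balanceCut ε₀ x : ℝ) * ((x : ℝ) + 2) ^ (θ / 8) ≤ (rpowCut ε x : ℝ) := by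
  filter_upwards [eventually_fullRegime_basic hε hε₀ hε₀' X₀,
    eventually_fullRegime_cut (by linarith) hθ hθ1 hθ2 hB,
    eventually_fullRegime_level hε hε₀ hε₀' hθ hθ2 hB] with x ha hb hc
  exact ⟨ha.1, ha.2.1, ha.2.2.1, ha.2.2.2.1, ha.2.2.2.2.1, ha.2.2.2.2.2, hb.1, hb.2.1, hb.2.2.1,
    hb.2.2.2, hc.1, hc.2⟩

/-! ### 3. (F′) in the kernel, and the unconditional headline -/

/-- **(F′) in the kernel.**  For all `0 < ε < ε₀ < 1/2`:
`U(x; ⌊x^{1-ε}⌋, ⌊x^{1/2-ε₀}⌋) = o(x)` — the unbalanced pairs `min(e₁,e₂) ≤ x^{1/2-ε₀}` of the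
located twin sum contribute `o(x)` (indeed `O_A(x (log x)^{-A})`).  Inputs: Bombieri–Vinogradov
for `μ` (cofactors `k ≤ x^θ`) and the Bombieri–Friedlander–Iwaniec bilinear theorem (cofactors
`k > x^θ`), `θ = min(ε₀, 1/4)`. -/
theorem twinUnbalancedSum_isLittleO {ε ε₀ : ℝ} (hε : 0 < ε) (hε₀ : ε < ε₀) (hε₀' : ε₀ < 1 / 2) :
    (fun x => twinUnbalancedSum x (rpowCut ε x) (balanceCut ε₀ x)) =o[atTop] fun x : ℕ => (x : ℝ) := by
  set θ : ℝ := min ε₀ (1 / 4) with hθdef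
  have hθ : 0 < θ := lt_min (by linarith) (by norm_num)
  have hθ1 : θ ≤ ε₀ := min_le_left _ _
  have hθ2 : θ ≤ 1 / 4 := min_le_right _ _
  have hε' : 0 < θ / 8 := by positivity
  have hε'1 : θ / 8 ≤ 1 / 8 := by linarith
  obtain ⟨B, C, X₀, hB, hC, hmain⟩ := abs_twinUnbalancedSum_le_full hε' hε'1 1 one_pos
  refine isLittleO_iff.2 fun c hc => ?_
  have hlog : ∀ᶠ x : ℕ in atTop, C / c ≤ Real.log (x : ℝ) :=
    (Real.tendsto_log_atTop.comp tendsto_natCast_atTop_atTop).eventually_ge_atTop _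
  filter_upwards [eventually_fullRegime hε hε₀ hε₀' hθ hθ1 hθ2 hB X₀, hlog,
    eventually_ge_atTop 2] with x hx hlx hx2
  obtain ⟨h1, h2, h3, h4, h5, h6, h7, h8, h9, h10, h11, h12⟩ := hx
  have hU := hmain x (rpowCut ε x) (balanceCut ε₀ x) ⌊(x : ℝ) ^ θ⌋₊
    ((x + 2) * balanceCut ε₀ x / rpowCut ε x) h1 h2 h3 h4 h5 h6 h7 h8 h9 h10 h11 h12
  have hx0 : (0 : ℝ) < x := by exact_mod_cast (show 0 < x by omega)
  have hl0 : 0 < Real.log (x : ℝ) := Real.log_pos (by exact_mod_cast (show 1 < x by omega))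
  rw [Real.rpow_one] at hU
  rw [Real.norm_eq_abs, Real.norm_eq_abs, abs_of_pos hx0]
  have hCc : C ≤ Real.log (x : ℝ) * c := (div_le_iff₀ hc).mp hlx
  calc |twinUnbalancedSum x (rpowCut ε x) (balanceCut ε₀ x)| ≤ C * x / Real.log x := hU
    _ ≤ c * x := by
        rw [div_le_iff₀ hl0]
        nlinarith [mul_le_mul_of_nonneg_right hCc hx0.le]

/-- **Unconditional headline (paper.md Cor. 20.4 with (F′) discharged).**  For all
`0 < ε < ε₀ < 1/2`:
`π₂(x) ~ 2C₂ x/log²x  ⟺  ∑_{e₁,e₂ > x^{1/2-ε₀}, e₁e₂ > x^{1-ε}} μ(e₁)μ(e₂) log²(e₁e₂) N(e₁,e₂;x) = o(x)`,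
`N(e₁,e₂;x) = #{n ≤ x odd : e₁ ∣ n, e₂ ∣ n+2} + #{m ≤ x/2 : e₁ ∣ m, e₂ ∣ m+1}`.  No hypothesis:
the twin prime asymptotic is equivalent to cancellation in the BALANCED large-product part of the
located Möbius sum alone. -/
theorem twinPrime_iff_balancedSum_rpow_all {ε ε₀ : ℝ} (hε : 0 < ε) (hε₀ : ε < ε₀)
    (hε₀' : ε₀ < 1 / 2) :
    (fun x : ℕ => (twinPrimeCount x : ℝ)) ~[atTop]
        (fun x : ℕ => 2 * twinPrimeConst * x / Real.log x ^ 2) ↔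
      (fun x => twinBalancedFarSum x (rpowCut ε x) (balanceCut ε₀ x) (rpowCut ε x))
        =o[atTop] fun x : ℕ => (x : ℝ) :=
  twinPrime_iff_balancedSum_rpow hε (by linarith) ε₀ (twinUnbalancedSum_isLittleO hε hε₀ hε₀')

/-- **The same with a product window (paper.md Cor. 20.3 with (F′) discharged).**  For all
`0 < ε < ε₀ < 1/2` and any `η`, under the ONE remaining prose premise `hW` = (F) (the balanced
window `x^{1-ε} < e₁e₂ ≤ x^{1+η}` is `o(x)`; NOT proved in the kernel):
`π₂(x) ~ 2C₂ x/log²x ⟺` the balanced far tail `e₁e₂ > x^{1+η}` is `o(x)`. -/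
theorem twinPrime_iff_balancedFarTail_rpow_all {ε ε₀ : ℝ} (hε : 0 < ε) (hε₀ : ε < ε₀)
    (hε₀' : ε₀ < 1 / 2) {η : ℝ}
    (hW : (fun x => twinBalancedWindowSum x (rpowCut ε x) (balanceCut ε₀ x) (productLevel η x))
      =o[atTop] fun x : ℕ => (x : ℝ)) :
    (fun x : ℕ => (twinPrimeCount x : ℝ)) ~[atTop]
        (fun x : ℕ => 2 * twinPrimeConst * x / Real.log x ^ 2) ↔
      (fun x => twinBalancedFarSum x (rpowCut ε x) (balanceCut ε₀ x) (productLevel η x))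
        =o[atTop] fun x : ℕ => (x : ℝ) :=
  twinPrime_iff_balancedFarTail_rpow hε (by linarith)
    (twinUnbalancedSum_isLittleO hε hε₀ hε₀') hW

end Summit.Parity.BatemanHorn.Theorems
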